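import Literature.AlgebraicGeometry.AbelianSchemes.AbelianSchemeDualTransportOfBaseChangeAnyBase
import Literature.AlgebraicGeometry.AbelianSchemes.PolarizationUnitHypothesis
import Literature.AlgebraicGeometry.AbelianSchemes.PolarizedAbelianSchemeWithLevelBaseChange
import HarnessLib

/-!
# The dual transport along base-change squares is FUNCTORIAL; the five-clause pull-back relation of triples from the
# `A`-square, the level clause and the `λ`-clause alone

Topic `AlgebraicGeometry/AbelianSchemes`; namespaces `…AbelianSchemeOver.DualPair` and `…PolarizedAbelianSchemeWithLevel`.
Cell hodgecm-mathlib (D-0151), sequel of ★ FILE A `AbelianSchemeDualTransportOfBaseChange` / ★ A2 `…AnyBase`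
(hand (h7)(D-F3)); consumers F-3 (Q5) («`dualPairOf_baseChange`»: formation of the dual commutes with base change,
functorially) and F-8 (8c)/(8e) (every exhibited pull-back square of TRIPLES).  THEOREMS ONLY (no def, no instance, no
notation, no `sorry`).

★ FILE A attaches to a cartesian chart `G : A' → A` of abelian schemes over `g : S' → S` (`h : A'.IsBaseChangeVia A g G`)
and dual pairs `D`, `D'` THE dual transport `Ĝ_h := hatTransportOfBaseChange D D' h : Â' → Â` over `g`, characterised
by the Poincaré clause `(G × Ĝ_h)^*𝒫 ≅ 𝒫'` ([MilneAV2008, I §8] «unique»).  Uniqueness makes it functorial: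

* §1 `hatTransportOfBaseChange_refl` (`Ĝ_{𝟙} = 𝟙`), **`hatTransportOfBaseChange_trans`** (`Ĝ_{h' ≫ h} = Ĝ_{h'} ≫ Ĝ_h`,
  via ★ `nonempty_pullback_map_comp_iso`), `hatTransportOfBaseChange_baseChange` (for the CHOSEN base change
  `D.baseChange g` the dual transport is the projection `Â ×_S S' → Â`, ★ `nonempty_pullback_map_P_iso_baseChange_P`),
  `hatTransportOfBaseChange_eq_of_isBaseChangeVia` (the `Ĝ` of ANY five-clause relation ★
  `PolarizedAbelianSchemeWithLevel.IsBaseChangeVia` IS `Ĝ_h`) — [MumfordFogartyKirwan1994, Cor. 6.8 / remark after Def.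
  7.5]: `(X ×_S T)^ = X̂ ×_S T` compatibly with composition of base changes;
* §2 **`PolarizedAbelianSchemeWithLevel.isBaseChangeVia_of_hatTransportOfBaseChange`** — for triples `P'/S'`, `P/S`, a
  cartesian chart `G` of the abelian schemes with the LEVEL clause and the `λ`-CLAUSE `λ' ≫ Ĝ_h = G ≫ λ` for the dual
  transport `Ĝ_h`, the five-clause relation `P'.IsBaseChangeVia P g G Ĝ_h` holds over a locally Noetherian `S'` under the
  unit hypotheses — the `X̂`-clause (★ A2) and the Poincaré clause (★ A) come for free; and
  **`isBaseChangeVia_of_hatTransportOfBaseChange_of_isReduced`** — over REDUCED locally Noetherian `S'` and reduced `S`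
  the unit hypotheses are discharged by the polarisations (★ `Polarization.nonempty_unitHatSlice_iso`), so a consumer
  exhibiting a pull-back square of triples proves THREE clauses instead of five.

HC_CM is proved only modulo the printed citations until rung 0 closes; this file discharges none of them.

## References
* [MumfordFogartyKirwan1994] D. Mumford, J. Fogarty, F. Kirwan, *Geometric Invariant Theory*, 3rd ed. (1994), Ch. 6 §1
  Cor. 6.8 (p. 118); Ch. 7 §2 Def. 7.2 (p. 129), Def. 7.3 (p. 129), remark after Def. 7.5 (p. 130).
* [MilneAV2008] J. S. Milne, *Abelian Varieties* (v2.00, 2008), I §8 pp. 36–37.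
-/

universe u

open CategoryTheory CategoryTheory.Limits AlgebraicGeometry MonoidalCategory

noncomputable section

namespace Literature.AlgebraicGeometry.AbelianSchemes

namespace AbelianSchemeOver

open scoped MonObj

namespace DualPair

/-! ### §1 Functoriality of the dual transport along squares -/

section Refl

variable {S : Scheme.{u}} {A : AbelianSchemeOver S} (D : A.DualPair)

/-- **`Ĝ_{𝟙} = 𝟙`**: the dual transport along the identity square is the identity (uniqueness; the identity carries the
Poincaré clause, ★ `PolarizedAbelianSchemeWithLevel.IsBaseChangeVia.refl`'s computation `(𝟙 × 𝟙)^*𝒫 ≅ 𝒫`).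
[cite: MilneAV2008, I §8 pp. 36–37] [cite: MumfordFogartyKirwan1994, Ch. 7 §2 Definition 7.2 (p. 129)] -/
theorem hatTransportOfBaseChange_refl :
    hatTransportOfBaseChange D D (IsBaseChangeVia.refl A) = 𝟙 D.hat.X.left := by
  symm
  refine eq_hatTransportOfBaseChange_of_nonempty_pullback_map_iso D D (IsBaseChangeVia.refl A) (𝟙 _)
    (by rw [Category.id_comp, Category.comp_id]) (by rw [Category.id_comp, Category.comp_id]) ?_
  have hmap : pullback.map A.X.hom D.hat.X.hom A.X.hom D.hat.X.hom (𝟙 _) (𝟙 _) (𝟙 S)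
      (by rw [Category.id_comp, Category.comp_id]) (by rw [Category.id_comp, Category.comp_id]) = 𝟙 _ :=
    pullback.hom_ext (by rw [pullback.lift_fst, Category.id_comp, Category.comp_id])
      (by rw [pullback.lift_snd, Category.id_comp, Category.comp_id])
  rw [hmap]
  exact ⟨(Scheme.Modules.pullbackId _).app D.P⟩

end Refl

section Trans

variable {S S' S'' : Scheme.{u}} {A : AbelianSchemeOver S} {A' : AbelianSchemeOver S'} {A'' : AbelianSchemeOver S''}
  {g : S' ⟶ S} {G : A'.X.left ⟶ A.X.left} {g' : S'' ⟶ S'} {G' : A''.X.left ⟶ A'.X.left}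
  (D : A.DualPair) (D' : A'.DualPair) (D'' : A''.DualPair) (h : A'.IsBaseChangeVia A g G)
  (h' : A''.IsBaseChangeVia A' g' G')

/-- **`Ĝ_{h' ≫ h} = Ĝ_{h'} ≫ Ĝ_h`**: the dual transport along a composite square is the composite of the dual transports —
the composite lies over `g' ≫ g` and carries the composite Poincaré clause (★ `nonempty_pullback_map_comp_iso`), so
uniqueness applies.  [MumfordFogartyKirwan1994] Cor. 6.8: `(X ×_S T)^ = X̂ ×_S T`, compatibly with `T' → T → S`.
[cite: MumfordFogartyKirwan1994, Ch. 6 §1 Cor. 6.8 (p. 118) and Ch. 7 §2 remark after Definition 7.5 (p. 130)]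
[cite: MilneAV2008, I §8 pp. 36–37] -/
theorem hatTransportOfBaseChange_trans :
    hatTransportOfBaseChange D D'' (h'.trans h) =
      hatTransportOfBaseChange D' D'' h' ≫ hatTransportOfBaseChange D D' h := by
  symm
  have wG : A'.X.hom ≫ g = G ≫ A.X.hom := h.fst.symm
  have wG' : A''.X.hom ≫ g' = G' ≫ A'.X.hom := h'.fst.symm
  have wĜ : D'.hat.X.hom ≫ g = hatTransportOfBaseChange D D' h ≫ D.hat.X.hom :=
    (hatTransportOfBaseChange_comp_hom D D' h).symm
  have wĜ' : D''.hat.X.hom ≫ g' = hatTransportOfBaseChange D' D'' h' ≫ D'.hat.X.hom :=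
    (hatTransportOfBaseChange_comp_hom D' D'' h').symm
  have hover : (hatTransportOfBaseChange D' D'' h' ≫ hatTransportOfBaseChange D D' h) ≫ D.hat.X.hom =
      D''.hat.X.hom ≫ g' ≫ g := by
    rw [Category.assoc, ← wĜ, ← Category.assoc, ← wĜ', Category.assoc]
  have wG'' : A''.X.hom ≫ g' ≫ g = (G' ≫ G) ≫ A.X.hom := (h'.trans h).fst.symm
  exact eq_hatTransportOfBaseChange_of_nonempty_pullback_map_iso D D'' (h'.trans h) _ hover wG''
    (nonempty_pullback_map_comp_iso D D' D'' wG wĜ wG' wĜ'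
      (nonempty_pullback_map_hatTransportOfBaseChange_iso D D' h wG wĜ)
      (nonempty_pullback_map_hatTransportOfBaseChange_iso D' D'' h' wG' wĜ') wG'' hover.symm)

end Trans

section Chosen

variable {S S' : Scheme.{u}} {A : AbelianSchemeOver S} (D : A.DualPair) (g : S' ⟶ S)

/-- **For the CHOSEN base change the dual transport is the projection**: `Ĝ_{A ×_S S' → A} = pr : Â ×_S S' → Â` for the
base-changed dual pair ★ `D.baseChange g` (its Poincaré sheaf is `(pr × pr)^*𝒫` by construction, ★
`nonempty_pullback_map_P_iso_baseChange_P`). [cite: MumfordFogartyKirwan1994, Ch. 6 §1 Cor. 6.8 (p. 118)] [cite: MilneAV2008, I §8 pp. 36–37] -/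
theorem hatTransportOfBaseChange_baseChange :
    hatTransportOfBaseChange D (D.baseChange g) (A.baseChange_isBaseChangeVia g) = pullback.fst D.hat.X.hom g := by
  symm
  have wA : (A.baseChange g).X.hom ≫ g = pullback.fst A.X.hom g ≫ A.X.hom :=
    (pullback.condition (f := A.X.hom) (g := g)).symm
  have wH : (D.baseChange g).hat.X.hom ≫ g = pullback.fst D.hat.X.hom g ≫ D.hat.X.hom :=
    (pullback.condition (f := D.hat.X.hom) (g := g)).symm
  exact eq_hatTransportOfBaseChange_of_nonempty_pullback_map_iso D (D.baseChange g) (A.baseChange_isBaseChangeVia g) _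
    wH.symm wA (D.nonempty_pullback_map_P_iso_baseChange_P g wA wH)

end Chosen

end DualPair

end AbelianSchemeOver

/-! ### §1b The `Ĝ` of any five-clause relation of triples is the dual transport -/

namespace PolarizedAbelianSchemeWithLevel

open AbelianSchemeOver
open scoped MonObj

variable {g₀ N : ℕ} {δ : Fin g₀ → ℕ} {S S' : Scheme.{u}} {P' : PolarizedAbelianSchemeWithLevel g₀ N δ S'}
  {P : PolarizedAbelianSchemeWithLevel g₀ N δ S} {f : S' ⟶ S} {G : P'.A.X.left ⟶ P.A.X.left}
  {Ĝ : P'.D.hat.X.left ⟶ P.D.hat.X.left}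

/-- **The `Ĝ` of ANY pull-back relation of triples IS the dual transport** along its `A`-square (uniqueness of the dual
transport read on the Poincaré clause of the relation). [cite: MilneAV2008, I §8 pp. 36–37]
[cite: MumfordFogartyKirwan1994, Ch. 7 §2 Definition 7.3 (p. 129)] -/
theorem IsBaseChangeVia.hat_eq_hatTransportOfBaseChange (hBC : P'.IsBaseChangeVia P f G Ĝ) :
    Ĝ = DualPair.hatTransportOfBaseChange P.D P'.D hBC.1.1 := by
  obtain ⟨hl, -, ⟨wG, wĜ, hP⟩, -⟩ := hBC
  exact DualPair.eq_hatTransportOfBaseChange_of_nonempty_pullback_map_iso P.D P'.D hl.1 Ĝ wĜ.symm wG hP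

/-! ### §2 The five-clause relation from the `A`-square, the level clause and the `λ`-clause -/

/-- **THREE CLAUSES INSTEAD OF FIVE**: for triples `P'/S'`, `P/S` (`S'` locally Noetherian), a cartesian chart
`G : A' → A` over `f` carrying the level structures (`P'.level.IsBaseChangeVia P.level f G`) and the `λ`-clause
`λ' ≫ Ĝ = G ≫ λ` for THE dual transport `Ĝ := hatTransportOfBaseChange P.D P'.D _`, under the unit hypotheses
`𝒫|_{A × {ε_Â}} ≅ 𝒪` for both dual pairs, the full relation `P'.IsBaseChangeVia P f G Ĝ` holds: the `X̂`-clause is ★ A2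
`hat_isBaseChangeVia_hatTransportOfBaseChange_of_isLocallyNoetherian_base` and the Poincaré clause is ★ A
`nonempty_pullback_map_hatTransportOfBaseChange_iso`. [cite: MumfordFogartyKirwan1994, Ch. 7 §2 Definition 7.2 (p. 129)]
[cite: MumfordFogartyKirwan1994, Ch. 6 §1 Cor. 6.8 (p. 118)] [cite: MilneAV2008, I §8 pp. 36–37] -/
theorem isBaseChangeVia_of_hatTransportOfBaseChange [IsLocallyNoetherian S']
    (hl : P'.level.IsBaseChangeVia P.level f G)
    (hD : Nonempty ((Scheme.Modules.pullback (DualPair.unitHatSlice P.D)).obj P.D.P ≅ SheafOfModules.unit _))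
    (hD' : Nonempty ((Scheme.Modules.pullback (DualPair.unitHatSlice P'.D)).obj P'.D.P ≅ SheafOfModules.unit _))
    (hlam : P'.pol.lam.left ≫ DualPair.hatTransportOfBaseChange P.D P'.D hl.1 = G ≫ P.pol.lam.left) :
    P'.IsBaseChangeVia P f G (DualPair.hatTransportOfBaseChange P.D P'.D hl.1) :=
  ⟨hl, DualPair.hat_isBaseChangeVia_hatTransportOfBaseChange_of_isLocallyNoetherian_base P.D P'.D hl.1 hD hD',
    ⟨hl.1.fst.symm, (DualPair.hatTransportOfBaseChange_comp_hom P.D P'.D hl.1).symm,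
      DualPair.nonempty_pullback_map_hatTransportOfBaseChange_iso P.D P'.D hl.1 _ _⟩, hlam⟩

/-- **THREE CLAUSES, NO UNIT HYPOTHESES over REDUCED bases**: as above with `S'` reduced locally Noetherian and `S`
reduced — the unit hypotheses come from the polarisations `λ`, `λ'` (★ `Polarization.nonempty_unitHatSlice_iso`,
[MumfordAV1970, §5 Cor. 6] via the universal property). [cite: MumfordFogartyKirwan1994, Ch. 7 §2 Definition 7.2 (p. 129)]
[cite: MilneAV2008, I §8 pp. 36–37] -/
theorem isBaseChangeVia_of_hatTransportOfBaseChange_of_isReduced [IsLocallyNoetherian S'] [IsReduced S'] [IsReduced S]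
    (hl : P'.level.IsBaseChangeVia P.level f G)
    (hlam : P'.pol.lam.left ≫ DualPair.hatTransportOfBaseChange P.D P'.D hl.1 = G ≫ P.pol.lam.left) :
    P'.IsBaseChangeVia P f G (DualPair.hatTransportOfBaseChange P.D P'.D hl.1) :=
  isBaseChangeVia_of_hatTransportOfBaseChange hl P.pol.nonempty_unitHatSlice_iso P'.pol.nonempty_unitHatSlice_iso hlam

/-- **Existence form**: under the same three clauses there IS a five-clause relation `P'.IsBaseChangeVia P f G Ĝ` (with
`Ĝ` the dual transport) — the shape ★ `exists_isBaseChangeVia`-type consumers read. [cite: MumfordFogartyKirwan1994, Ch. 7 §2 Definition 7.2 (p. 129)] -/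
theorem exists_isBaseChangeVia_of_isReduced [IsLocallyNoetherian S'] [IsReduced S'] [IsReduced S]
    (hl : P'.level.IsBaseChangeVia P.level f G)
    (hlam : P'.pol.lam.left ≫ DualPair.hatTransportOfBaseChange P.D P'.D hl.1 = G ≫ P.pol.lam.left) :
    ∃ Ĝ : P'.D.hat.X.left ⟶ P.D.hat.X.left, P'.IsBaseChangeVia P f G Ĝ :=
  ⟨_, isBaseChangeVia_of_hatTransportOfBaseChange_of_isReduced hl hlam⟩

end PolarizedAbelianSchemeWithLevel

end Literature.AlgebraicGeometry.AbelianSchemes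

end
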